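import Literature.NumberTheory.GaloisRepresentations.GaloisCohomologyKummerProofs
import Literature.FieldTheory.Galois.FixingSubgroupAbsoluteGalois
import HarnessLib

/-!
# Kummer theory at the cocycle level for a normal extension `L/K` and for `Gal(L/K) ≤ Gal(L/F)`

J.-P. Serre, *Local Fields*, GTM 67 (1979), Ch. X §3 b) (Kummer theory) with Ch. X §1, Prop. 2
(Hilbert's Theorem 90 for infinite Galois extensions) [cite: Serre1979, Ch. X §3 b)].
PROOF-ONLY file (no definition, no named fact), companion of
`GaloisCohomologyKummerCocycles.lean` (the same statement for `Γ_K = Field.absoluteGaloisGroup K`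
acting on Mathlib's `AlgebraicClosure K`): here the acting group is

* `Aut_K(L) = (L ≃ₐ[K] L)` with the Krull topology, for ANY normal extension `L/K`
  (`AlgEquiv.exists_kummer_eq_of_isOpen`): a `μₙ(L)`-valued multiplicative 1-cocycle
  `f(gh) = g(f h) · f g` whose kernel `{f = 1}` is Krull-open (= `f` locally constant) is EXACTLY a
  Kummer cocycle `g ↦ g(α)/α` with `αⁿ ∈ Kˣ` (`n` invertible in `K`; no perfectness: the
  exponential-characteristic/Bezout step of the absolute file is repeated verbatim);
* the closed subgroup `Gal(L/K) = K.fixingSubgroup ≤ Gal(L/F) = (L ≃ₐ[F] L)` of an intermediate field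
  `F ⊆ K ⊆ L` with the SUBSPACE Krull topology
  (`IntermediateField.exists_kummer_eq_of_isLocallyConstant_cocycle`) — the shape in which the
  Galois group of a finite extension `K` of `ℚ_p` INSIDE a fixed `ℚ̄_p` appears in the abc-iut cell
  (`TemperedCurve.GK = K.fixingSubgroup ≤ Gal(ℚ̄_p/ℚ_p)`); transported along the tree's homeomorphism
  `Literature.FieldTheory.Galois.fixingSubgroupContinuousMulEquiv K (AlgEquiv.refl) :
  K.fixingSubgroup ≃ₜ* (L ≃ₐ[K] L)`;
* `…_forall_root` variants: relative to an ARBITRARY `n`-th root `α'` of the same `a ∈ Kˣ` the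
  cocycle is `(σα'/α') · (σζ/ζ)` with `ζ ∈ μₙ(L)` (the form for a fixed root-choice function).

Consumer: abc-iut GAP-LEDGER G-L2t11-2 (a) «continuous Kummer adapter» (L2-lead gen 3 R1/R31; seat
abc-iut-w5-d234; consumer abc-iut-L2-t11 `hKumC_of_hilbert90` in `Discharge/Sec5KummerGaloisDictionary.lean`).
Nothing of [EtTh] is used or asserted; classical and undisputed.
-/

noncomputable section

namespace Literature.NumberTheory.GaloisRepresentations

open Field Topology

universe u v

/-! ### Any normal extension `L/K`: continuous `μₙ`-cocycles of `Aut_K(L)` are Kummer cocycles -/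

/-- **Kummer theory at the cocycle level for a normal extension `L/K`.** For `n` invertible in `K`,
a multiplicative `1`-cocycle `f : Aut_K(L) → Lˣ`, `f(gh) = g(f h) · f g`, with values in `μₙ(L)` and
Krull-open kernel `{f = 1}` is EXACTLY the Kummer cocycle `g ↦ g(α)/α` of an `n`-th root `α ∈ Lˣ` of
some `a ∈ Kˣ`. (Hilbert 90: `f g = gβ/β`; `βⁿ` is `Aut_K(L)`-fixed, so `β^{n q^m} ∈ K` with `q` the
exponential characteristic — `L/K` normal; Bezout `u q^m + v n = 1` and `fⁿ = 1` give
`f = (f^{q^m})ᵘ`, the Kummer cocycle of `α := (β^{q^m})ᵘ`.) [cite: Serre1979, Ch. X §3 b)] -/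
theorem AlgEquiv.exists_kummer_eq_of_isOpen {K : Type u} {L : Type v} [Field K] [Field L]
    [Algebra K L] [Normal K L] (n : ℕ) [NeZero (n : K)] (f : (L ≃ₐ[K] L) → Lˣ)
    (hf : ∀ g h, f (g * h) = g • f h * f g) (hopen : IsOpen {g | f g = 1})
    (hn : ∀ g, f g ^ n = 1) :
    ∃ (a : Kˣ) (α : Lˣ), α ^ n = Units.map (algebraMap K L : K →* L) a ∧ ∀ g, f g = g • α / α := by
  obtain ⟨q, hq⟩ := ExpChar.exists K
  obtain ⟨γ, hγ⟩ := AlgEquiv.exists_smul_div_eq_of_isOpen f hf hopen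
  -- `γⁿ` is `Aut_K(L)`-fixed
  have hfix : ∀ g : L ≃ₐ[K] L, g • γ ^ n = γ ^ n := by
    intro g
    have h := hn g
    rwa [← hγ g, div_pow, ← smul_pow', div_eq_one] at h
  have hfix' : ∀ g : L ≃ₐ[K] L, g ((γ ^ n : Lˣ) : L) = (γ ^ n : Lˣ) := by
    intro g
    have h := congrArg (fun u : Lˣ => (u : L)) (hfix g)
    simpa only [AlgEquiv.smul_units_def, Units.coe_map, MonoidHom.coe_coe] using h
  -- `(γⁿ)^(q^m) = a₀ ∈ K`
  obtain ⟨m, ha₀⟩ := exists_pow_mem_range_of_forall_algEquiv (F := K) q hfix'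
  obtain ⟨a₀, ha₀⟩ := ha₀
  have ha₀0 : a₀ ≠ 0 := by
    intro h
    apply pow_ne_zero (q ^ m) (γ ^ n).ne_zero
    rw [← ha₀, h, map_zero]
  set a₁ : Kˣ := Units.mk0 a₀ ha₀0 with ha₁
  have ha₁' : Units.map (algebraMap K L : K →* L) a₁ = (γ ^ q ^ m) ^ n := by
    ext
    rw [Units.coe_map, MonoidHom.coe_coe, ha₁, Units.val_mk0, ha₀]
    push_cast
    ring
  -- Bezout: `u * q^m + v * n = 1`
  obtain ⟨u, v, huv⟩ := Nat.isCoprime_iff_coprime.2 (coprime_expChar_pow_of_neZero K q n m)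
  have hpow : ∀ x : Lˣ, (x ^ u) ^ n = (x ^ n) ^ u := fun x => by
    rw [← zpow_natCast, ← zpow_mul, ← zpow_natCast x n, ← zpow_mul, mul_comm]
  refine ⟨a₁ ^ u, (γ ^ q ^ m) ^ u, ?_, fun g => ?_⟩
  · rw [map_zpow, ha₁', hpow]
  · have hk : g • ((γ ^ q ^ m) ^ u) / (γ ^ q ^ m) ^ u = ((f g) ^ ((q ^ m : ℕ) : ℤ)) ^ u := by
      rw [smul_zpow', ← div_zpow, smul_pow', ← div_pow, hγ g, zpow_natCast]
    rw [hk]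
    calc f g = f g ^ (1 : ℤ) := (zpow_one _).symm
      _ = f g ^ (u * ((q ^ m : ℕ) : ℤ) + v * (n : ℤ)) := by rw [huv]
      _ = (f g ^ ((q ^ m : ℕ) : ℤ)) ^ u * (f g ^ (n : ℤ)) ^ v := by
          rw [zpow_add, mul_comm u, zpow_mul, mul_comm v, zpow_mul]
      _ = (f g ^ ((q ^ m : ℕ) : ℤ)) ^ u := by rw [zpow_natCast (f g) n, hn g, one_zpow, mul_one]

/-- The same relative to an ARBITRARY `n`-th root `α'` of the `a ∈ Kˣ` produced: `f g = (gα'/α')·(gζ/ζ)`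
for some `ζ ∈ μₙ(L)`. [cite: Serre1979, Ch. X §3 b)] -/
theorem AlgEquiv.exists_kummer_eq_of_isOpen_forall_root {K : Type u} {L : Type v} [Field K] [Field L]
    [Algebra K L] [Normal K L] (n : ℕ) [NeZero (n : K)] (f : (L ≃ₐ[K] L) → Lˣ)
    (hf : ∀ g h, f (g * h) = g • f h * f g) (hopen : IsOpen {g | f g = 1})
    (hn : ∀ g, f g ^ n = 1) :
    ∃ a : Kˣ, ∀ α' : Lˣ, α' ^ n = Units.map (algebraMap K L : K →* L) a →
      ∃ ζ : Lˣ, ζ ^ n = 1 ∧ ∀ g, f g = (g • α' / α') * (g • ζ / ζ) := by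
  obtain ⟨a, α, hα, hfα⟩ := AlgEquiv.exists_kummer_eq_of_isOpen n f hf hopen hn
  refine ⟨a, fun α' hα' => ⟨α / α', ?_, fun g => ?_⟩⟩
  · rw [div_pow, hα, hα', div_self']
  · rw [hfα g, smul_div', div_mul_div_comm, mul_div_cancel, mul_comm, div_mul_eq_mul_div,
      mul_div_assoc, div_self', mul_one]

/-! ### `Gal(L/K) ≤ Gal(L/F)` for an intermediate field, with the subspace Krull topology -/

section Fixing

variable {F : Type u} {L : Type v} [Field F] [Field L] [Algebra F L]
  (K : IntermediateField F L) (n : ℕ) [NeZero (n : F)]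

/-- `n` invertible in `F` is invertible in the intermediate field `K`. [folklore] -/
private theorem IntermediateField.neZero_natCast_of_neZero : NeZero (n : K) := by
  refine ⟨fun h => NeZero.ne (n : F) ?_⟩
  have h' : algebraMap F K (n : F) = 0 := by rw [map_natCast, h]
  exact (map_eq_zero_iff _ (algebraMap F K).injective).1 h'

variable [Normal F L]

/-- **Kummer theory at the cocycle level for `Gal(L/K) ≤ Gal(L/F)`** (`F ⊆ K ⊆ L`, `L/F` normal and
algebraic, `n` invertible in `F`): a locally constant (subspace Krull topology) `μₙ(L)`-valued
multiplicative `1`-cocycle `c : K.fixingSubgroup → Lˣ`, `c(στ) = c σ · σ(c τ)`, is EXACTLY the Kummer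
cocycle `σ ↦ σ(α)/α` of an `n`-th root `α ∈ Lˣ` of some `a ∈ Kˣ` (transport along the tree's
homeomorphism `K.fixingSubgroup ≃ₜ* (L ≃ₐ[K] L)` + `AlgEquiv.exists_kummer_eq_of_isOpen`).
[cite: Serre1979, Ch. X §3 b)] -/
theorem IntermediateField.exists_kummer_eq_of_isLocallyConstant_cocycle
    {c : K.fixingSubgroup → Lˣ} (hc : IsLocallyConstant c) (hn : ∀ σ, c σ ^ n = 1)
    (hcoc : ∀ σ τ, c (σ * τ) = c σ * (σ : L ≃ₐ[F] L) • c τ) :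
    ∃ (a : (↥K)ˣ) (α : Lˣ), α ^ n = Units.map (algebraMap K L : K →* L) a ∧
      ∀ σ, c σ = (σ : L ≃ₐ[F] L) • α / α := by
  haveI : Normal K L := Normal.tower_top_of_normal F K L
  haveI : NeZero (n : K) := IntermediateField.neZero_natCast_of_neZero K n
  let e : K.fixingSubgroup ≃* (L ≃ₐ[K] L) :=
    Literature.FieldTheory.Galois.fixingSubgroupMulEquiv K (AlgEquiv.refl : L ≃ₐ[K] L)
  have hecont : Continuous e.symm :=
    Literature.FieldTheory.Galois.continuous_fixingSubgroupMulEquiv_symm K (AlgEquiv.refl : L ≃ₐ[K] L)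
  -- the action of `σ ∈ Gal(L/K) ≤ Gal(L/F)` on `Lˣ` is that of `e σ ∈ Aut_K(L)`
  have hact : ∀ (τ : L ≃ₐ[K] L) (x : Lˣ), ((e.symm τ : K.fixingSubgroup) : L ≃ₐ[F] L) • x = τ • x := by
    intro τ x
    ext
    rw [AlgEquiv.smul_units_def, AlgEquiv.smul_units_def, Units.coe_map, Units.coe_map,
      MonoidHom.coe_coe, MonoidHom.coe_coe]
    exact Literature.FieldTheory.Galois.fixingSubgroupMulEquiv_symm_apply K AlgEquiv.refl τ x
  let f : (L ≃ₐ[K] L) → Lˣ := fun τ => c (e.symm τ)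
  have hf : ∀ g h, f (g * h) = g • f h * f g := by
    intro g h
    change c (e.symm (g * h)) = g • c (e.symm h) * c (e.symm g)
    rw [map_mul, hcoc, hact, mul_comm]
  have hopen : IsOpen {g | f g = 1} := by
    have : {g | f g = 1} = e.symm ⁻¹' (c ⁻¹' {1}) := rfl
    rw [this]
    exact (hc.isOpen_fiber 1).preimage hecont
  have hfn : ∀ g, f g ^ n = 1 := fun g => hn _
  obtain ⟨a, α, hα, hfα⟩ := AlgEquiv.exists_kummer_eq_of_isOpen n f hf hopen hfn
  refine ⟨a, α, hα, fun σ => ?_⟩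
  have h := hfα (e σ)
  rw [show f (e σ) = c σ from congrArg c (e.symm_apply_apply σ), ← hact, e.symm_apply_apply] at h
  exact h

/-- The same relative to an ARBITRARY `n`-th root `α'` of the `a ∈ Kˣ` produced: `c σ = (σα'/α')·(σζ/ζ)`
for some `ζ ∈ μₙ(L)` — the shape consumed with a fixed root-choice function `Kˣ → ⁿ√Kˣ ⊆ Lˣ`.
[cite: Serre1979, Ch. X §3 b)] -/
theorem IntermediateField.exists_kummer_eq_of_isLocallyConstant_cocycle_forall_root
    {c : K.fixingSubgroup → Lˣ} (hc : IsLocallyConstant c) (hn : ∀ σ, c σ ^ n = 1)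
    (hcoc : ∀ σ τ, c (σ * τ) = c σ * (σ : L ≃ₐ[F] L) • c τ) :
    ∃ a : (↥K)ˣ, ∀ α' : Lˣ, α' ^ n = Units.map (algebraMap K L : K →* L) a →
      ∃ ζ : Lˣ, ζ ^ n = 1 ∧ ∀ σ, c σ = ((σ : L ≃ₐ[F] L) • α' / α') * ((σ : L ≃ₐ[F] L) • ζ / ζ) := by
  obtain ⟨a, α, hα, hcα⟩ :=
    IntermediateField.exists_kummer_eq_of_isLocallyConstant_cocycle K n hc hn hcoc
  refine ⟨a, fun α' hα' => ⟨α / α', ?_, fun σ => ?_⟩⟩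
  · rw [div_pow, hα, hα', div_self']
  · rw [hcα σ, smul_div', div_mul_div_comm, mul_div_cancel, mul_comm, div_mul_eq_mul_div,
      mul_div_assoc, div_self', mul_one]

end Fixing

end Literature.NumberTheory.GaloisRepresentations

end
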